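import Mathlib
import Summits.Ventures.HodgeRepro.Tier4.Line1.RTFSetting
import Summits.Ventures.HodgeRepro.Tier4.Line1.ConvTest
import Summits.Ventures.HodgeRepro.Tier4.Line1.GeneratedSubspace
import Summits.Ventures.HodgeRepro.Tier4.Line1.BlockSimple
import Summits.Ventures.HodgeRepro.Tier4.Line1.InnerCalculus
import Summits.Ventures.HodgeRepro.Tier4.Line1.IsotypicIdempotent
import Summits.Ventures.HodgeRepro.Tier4.Line1.IsotypicSchur
import Summits.Ventures.HodgeRepro.Tier4.Line1.IsotypicBlock
import Summits.Ventures.HodgeRepro.Tier4.Line1.ConvAssoc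

/-!
# Tier4/Line1/IsotypicHeckeAlgebra — THE HECKE ALGEBRA OF TYPE σ `H_σ = eσ ⋆ C_c(G) ⋆ eσ` as a ℂ-algebra under
convolution, the type-σ block as an `H_σ`-MODULE, and (C1) for the type-σ block (module 6 of plan-1's cut (S3σ) S14082)

Blind re-derivation cell `pub-hodge-repro`, Tier 4 (README §9–§10), seat t4-L1-p3 (prover, LINE L1, gen 3).  Target tree
path `lean/Summits/Ventures/HodgeRepro/Tier4/Line1/IsotypicHeckeAlgebra.lean`.  Imports this seat's `ConvAssoc`
(p691474: `conv_assoc`), `IsotypicSchur` (`conv_eσ_eσ`), `IsotypicBlock` (`isotypicFixed`, `finiteDimensional_isotypicFixed`),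
`IsotypicIdempotent`; t4-L1-p2's `ConvTest` (`conv_isTest`), `GeneratedSubspace` (`R_R_eq_R_conv`, `R_add'`, `R_smul'`,
`R_zero'`), `BlockSimple` (`isSimpleModule_of_block`, `R_R_eq_R_conv_conv`); t4-L1-p4's `InnerCalculus`
(`inner_R_eq_inner_R_adj`) and `RelClosed` (`R_invariant`, `continuous_R_of_invariant`).  0 printed inputs.

CONTENT.  The bilinearity of the convolution on test functions (`conv_add_left/right`, `conv_smul_left/right`,
`conv_zero_left/right`); **`HeckeAlg S K ρ hKo hKc hρ`** = the test functions `t` with `eσ ⋆ t = t = t ⋆ eσ`, a ℂ-subspace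
of `G → ℂ` — a RING under convolution with unit `eσ` (`conv_assoc`, `conv_eσ_eσ`) and a ℂ-ALGEBRA; every `eσ ⋆ f ⋆ eσ`
lies in it (`heckeElt`).  **The type-σ block `isotypicFixed` is an `H_σ`-module** by `t • ψ := R(t) ψ` (`R_R_eq_R_conv`,
the fixed-space stability `R(eσ)(R(t)ψ) = R(eσ ⋆ t)ψ = R(t)ψ`), with `IsScalarTower ℂ H_σ Vb`.  Hence, for p5's
`IdempotentData` / p2's `isSimpleModule_of_block` on the type-σ block: `hact_heckeAlg` (the convolution law, `rfl`),
`hfull_heckeAlg` («`e A e = H`», `r := eσ ⋆ f ⋆ eσ` by p2's `R_R_eq_R_conv_conv`), `he_test_heckeAlg` (`f₀ := eσ`) are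
THEOREMS, and **`isSimpleModule_isotypic`** = (C1) for the type-σ block: every constituent `τ m' ∩ Vb` with a non-zero
vector is a simple `H_σ`-module (p2's theorem; `τ m'` invariant and irreducible displayed as in the line).  What stays
displayed: the constituents/projections bookkeeping, (C2), the instance's corner forms.  Nothing here moves (P).
Nothing here says anything about the status of the Hodge conjecture for CM abelian varieties, which is NOT proved
(HC_CM is NOT proved by anyone in this repository).
-/

set_option autoImplicit false

noncomputable section

namespace Summit.Ventures.HodgeRepro.Tier4.Line1

open MeasureTheory Topology Set

namespace RTF.Setting

variable {G : Type} [Group G] [TopologicalSpace G] [IsTopologicalGroup G] [MeasurableSpace G] [BorelSpace G]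
  (S : Setting G)

section Bilinear

omit [Group G] [IsTopologicalGroup G] [MeasurableSpace G] [BorelSpace G] in
/-- the sum of two test functions is a test function. -/
theorem isTest_add {f g : G → ℂ} (hf : IsTest f) (hg : IsTest g) : IsTest (f + g) :=
  ⟨hf.cont.add hg.cont, hf.compact.add hg.compact⟩

omit [Group G] [IsTopologicalGroup G] [MeasurableSpace G] [BorelSpace G] in
/-- a scalar multiple of a test function is a test function. -/
theorem isTest_const_smul {f : G → ℂ} (hf : IsTest f) (c : ℂ) : IsTest (c • f) :=
  ⟨hf.cont.const_smul c, hf.compact.comp_left (mul_zero c)⟩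

omit [Group G] [IsTopologicalGroup G] [MeasurableSpace G] [BorelSpace G] in
/-- `0` is a test function. -/
theorem isTest_zero : IsTest (0 : G → ℂ) :=
  ⟨continuous_const, HasCompactSupport.intro' isCompact_empty isClosed_empty fun _ _ => rfl⟩

/-- the integrand of `f ⋆ g` at `x` is integrable for test functions. -/
theorem integrable_conv_integrand {f g : G → ℂ} (hf : IsTest f) (hg : IsTest g) (x : G) :
    Integrable (fun h => f h * g (h⁻¹ * x)) S.μ := by
  haveI := S.haar
  exact (hf.cont.mul (hg.cont.comp (continuous_inv.mul continuous_const))).integrable_of_hasCompactSupport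
    hf.compact.mul_right

/-- `(f + g) ⋆ h = f ⋆ h + g ⋆ h` for test functions. -/
theorem conv_add_left {f g h : G → ℂ} (hf : IsTest f) (hg : IsTest g) (hh : IsTest h) :
    S.conv (f + g) h = S.conv f h + S.conv g h := by
  funext x
  simp only [conv, Pi.add_apply, add_mul]
  exact integral_add (S.integrable_conv_integrand hf hh x) (S.integrable_conv_integrand hg hh x)

/-- `f ⋆ (g + h) = f ⋆ g + f ⋆ h` for test functions. -/
theorem conv_add_right {f g h : G → ℂ} (hf : IsTest f) (hg : IsTest g) (hh : IsTest h) :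
    S.conv f (g + h) = S.conv f g + S.conv f h := by
  funext x
  simp only [conv, Pi.add_apply, mul_add]
  exact integral_add (S.integrable_conv_integrand hf hg x) (S.integrable_conv_integrand hf hh x)

omit [IsTopologicalGroup G] [BorelSpace G] in
/-- `(c • f) ⋆ g = c • (f ⋆ g)`. -/
theorem conv_smul_left (c : ℂ) (f g : G → ℂ) : S.conv (c • f) g = c • S.conv f g := by
  funext x
  simp only [conv, Pi.smul_apply, smul_eq_mul, mul_assoc]
  exact integral_const_mul c _

omit [IsTopologicalGroup G] [BorelSpace G] in
/-- `f ⋆ (c • g) = c • (f ⋆ g)`. -/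
theorem conv_smul_right (c : ℂ) (f g : G → ℂ) : S.conv f (c • g) = c • S.conv f g := by
  funext x
  simp only [conv, Pi.smul_apply, smul_eq_mul]
  rw [← integral_const_mul]
  congr 1
  funext h
  ring

omit [IsTopologicalGroup G] [BorelSpace G] in
/-- `0 ⋆ g = 0`. -/
theorem conv_zero_left (g : G → ℂ) : S.conv (0 : G → ℂ) g = 0 := by
  funext x
  simp [conv]

omit [IsTopologicalGroup G] [BorelSpace G] in
/-- `f ⋆ 0 = 0`. -/
theorem conv_zero_right (f : G → ℂ) : S.conv f (0 : G → ℂ) = 0 := by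
  funext x
  simp [conv]

/-- `R(f + g) ψ = R(f) ψ + R(g) ψ` for test functions `f g` and a continuous `ψ`. -/
theorem R_add_fun {f g : G → ℂ} (hf : IsTest f) (hg : IsTest g) {ψ : G → ℂ} (hψ : Continuous ψ) :
    S.R (f + g) ψ = S.R f ψ + S.R g ψ := by
  haveI := S.haar
  funext x
  simp only [R, Pi.add_apply, add_mul]
  refine integral_add ?_ ?_
  · exact (hf.cont.mul (hψ.comp (continuous_const.mul continuous_id))).integrable_of_hasCompactSupport
      hf.compact.mul_right
  · exact (hg.cont.mul (hψ.comp (continuous_const.mul continuous_id))).integrable_of_hasCompactSupport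
      hg.compact.mul_right

omit [IsTopologicalGroup G] [BorelSpace G] in
/-- `R(c • f) ψ = c • R(f) ψ`. -/
theorem R_smul_fun (c : ℂ) (f ψ : G → ℂ) : S.R (c • f) ψ = c • S.R f ψ := by
  funext x
  simp only [R, Pi.smul_apply, smul_eq_mul, mul_assoc]
  exact integral_const_mul c _

omit [IsTopologicalGroup G] [BorelSpace G] in
/-- `R(0) ψ = 0`. -/
theorem R_zero_fun (ψ : G → ℂ) : S.R (0 : G → ℂ) ψ = 0 := by
  funext x
  simp [R]

end Bilinear

section Algebra

variable (K : Subgroup G) {d : ℕ} (ρ : K →* Matrix (Fin d) (Fin d) ℂ)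
  (hKo : IsOpen (K : Set G)) (hKc : IsCompact (K : Set G)) (hρ : Continuous ρ)

/-- **THE HECKE ALGEBRA OF TYPE σ**: the test functions `t` with `eσ ⋆ t = t` and `t ⋆ eσ = t`, as a ℂ-subspace of
`G → ℂ` (the underlying space of `H_σ = eσ ⋆ C_c(G) ⋆ eσ`; `hirr` is carried as a parameter so that the unit `eσ`
of the ring structure below is inferable from the type). -/
def HeckeAlg (_hirr : IsIrreducibleRep ρ) : Submodule ℂ (G → ℂ) where
  carrier := {t | IsTest t ∧ S.conv (eσ S K ρ) t = t ∧ S.conv t (eσ S K ρ) = t}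
  add_mem' := by
    intro a b ha hb
    refine ⟨isTest_add ha.1 hb.1, ?_, ?_⟩
    · rw [S.conv_add_right (isTest_eσ S K ρ hKo hKc hρ) ha.1 hb.1, ha.2.1, hb.2.1]
    · rw [S.conv_add_left ha.1 hb.1 (isTest_eσ S K ρ hKo hKc hρ), ha.2.2, hb.2.2]
  zero_mem' := ⟨isTest_zero, S.conv_zero_right _, S.conv_zero_left _⟩
  smul_mem' := by
    intro c a ha
    refine ⟨isTest_const_smul ha.1 c, ?_, ?_⟩
    · rw [S.conv_smul_right, ha.2.1]
    · rw [S.conv_smul_left, ha.2.2]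

variable (hirr : IsIrreducibleRep ρ)

/-- membership in the Hecke algebra of type σ. -/
theorem mem_heckeAlg (t : G → ℂ) :
    t ∈ HeckeAlg S K ρ hKo hKc hρ hirr ↔ IsTest t ∧ S.conv (eσ S K ρ) t = t ∧ S.conv t (eσ S K ρ) = t := Iff.rfl

include hKo hKc hρ hirr in
/-- `eσ` is in the Hecke algebra of type σ (its unit). -/
theorem eσ_mem_heckeAlg : eσ S K ρ ∈ HeckeAlg S K ρ hKo hKc hρ hirr :=
  ⟨isTest_eσ S K ρ hKo hKc hρ, conv_eσ_eσ S K ρ hKo hKc hρ hirr, conv_eσ_eσ S K ρ hKo hKc hρ hirr⟩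

variable [SecondCountableTopology G] [T2Space G] [MeasurableMul G] [SFinite S.μ]

include hKo hKc hρ hirr in
/-- `eσ ⋆ f ⋆ eσ` is in the Hecke algebra of type σ, for every test function `f`. -/
theorem heckeElt_mem {f : G → ℂ} (hf : IsTest f) :
    S.conv (S.conv (eσ S K ρ) f) (eσ S K ρ) ∈ HeckeAlg S K ρ hKo hKc hρ hirr := by
  have he := isTest_eσ S K ρ hKo hKc hρ
  refine ⟨(S.conv_isTest (S.conv_isTest he hf).1 he).1, ?_, ?_⟩
  · rw [← S.conv_assoc he (S.conv_isTest he hf).1 he, ← S.conv_assoc he he hf,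
      conv_eσ_eσ S K ρ hKo hKc hρ hirr]
  · rw [S.conv_assoc (S.conv_isTest he hf).1 he he, conv_eσ_eσ S K ρ hKo hKc hρ hirr]

include hKo hKc hρ hirr in
/-- the product of two elements of the Hecke algebra is in the Hecke algebra. -/
theorem conv_mem_heckeAlg {t t' : G → ℂ} (ht : t ∈ HeckeAlg S K ρ hKo hKc hρ hirr)
    (ht' : t' ∈ HeckeAlg S K ρ hKo hKc hρ hirr) : S.conv t t' ∈ HeckeAlg S K ρ hKo hKc hρ hirr := by
  have he := isTest_eσ S K ρ hKo hKc hρ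
  refine ⟨(S.conv_isTest ht.1 ht'.1).1, ?_, ?_⟩
  · rw [← S.conv_assoc he ht.1 ht'.1, ht.2.1]
  · rw [S.conv_assoc ht.1 ht'.1 he, ht'.2.2]

/-- **`H_σ` IS A RING under convolution with unit `eσ`** (`conv_assoc`, `conv_eσ_eσ`, the bilinearity lemmas); the
additive structure is that of the subspace. -/
instance instRingHeckeAlg : Ring (HeckeAlg S K ρ hKo hKc hρ hirr) :=
  { (inferInstance : AddCommGroup (HeckeAlg S K ρ hKo hKc hρ hirr)) with
    mul := fun t t' => ⟨S.conv t t', S.conv_mem_heckeAlg K ρ hKo hKc hρ hirr t.2 t'.2⟩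
    one := ⟨eσ S K ρ, S.eσ_mem_heckeAlg K ρ hKo hKc hρ hirr⟩
    mul_assoc := fun a b c => Subtype.ext (S.conv_assoc a.2.1 b.2.1 c.2.1)
    one_mul := fun a => Subtype.ext a.2.2.1
    mul_one := fun a => Subtype.ext a.2.2.2
    left_distrib := fun a b c => Subtype.ext (S.conv_add_right a.2.1 b.2.1 c.2.1)
    right_distrib := fun a b c => Subtype.ext (S.conv_add_left a.2.1 b.2.1 c.2.1)
    zero_mul := fun a => Subtype.ext (S.conv_zero_left a)
    mul_zero := fun a => Subtype.ext (S.conv_zero_right a) }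

/-- the multiplication of `H_σ` is the convolution (`rfl`). -/
theorem heckeAlg_mul_coe (t t' : HeckeAlg S K ρ hKo hKc hρ hirr) :
    ((t * t' : HeckeAlg S K ρ hKo hKc hρ hirr) : G → ℂ) = S.conv t t' := rfl

/-- the unit of `H_σ` is `eσ` (`rfl`). -/
theorem heckeAlg_one_coe : ((1 : HeckeAlg S K ρ hKo hKc hρ hirr) : G → ℂ) = eσ S K ρ := rfl

/-- **`H_σ` IS A ℂ-ALGEBRA** (the subspace structure, `conv_smul_left/right`). -/
instance instAlgebraHeckeAlg : Algebra ℂ (HeckeAlg S K ρ hKo hKc hρ hirr) :=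
  Algebra.ofModule
    (fun c a b => Subtype.ext (by
      show S.conv (c • (a : G → ℂ)) b = c • S.conv a b
      exact S.conv_smul_left c a b))
    (fun c a b => Subtype.ext (by
      show S.conv (a : G → ℂ) (c • (b : G → ℂ)) = c • S.conv a b
      exact S.conv_smul_right c a b))

end Algebra

section Module

variable (K : Subgroup G) {d : ℕ} (ρ : K →* Matrix (Fin d) (Fin d) ℂ)
  (hKo : IsOpen (K : Set G)) (hKc : IsCompact (K : Set G)) (hρ : Continuous ρ) (hirr : IsIrreducibleRep ρ)
  [SecondCountableTopology G] [T2Space G] [MeasurableMul G] [SFinite S.μ]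

include hKo hKc hρ hirr in
/-- `R(t) ψ` lies in the type-σ block for `t ∈ H_σ` and `ψ` in the block (invariance, continuity, and
`R(eσ)(R(t)ψ) = R(eσ ⋆ t)ψ = R(t)ψ`). -/
theorem R_mem_isotypicFixed {t : G → ℂ} (ht : t ∈ HeckeAlg S K ρ hKo hKc hρ hirr) {ψ : G → ℂ}
    (hψ : ψ ∈ isotypicFixed S K ρ hKo hKc hρ) : S.R t ψ ∈ isotypicFixed S K ρ hKo hKc hρ := by
  refine ⟨S.R_invariant t hψ.1, S.continuous_R_of_invariant ht.1 hψ.1 hψ.2.1, ?_⟩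
  rw [S.R_R_eq_R_conv (isTest_eσ S K ρ hKo hKc hρ) ht.1 hψ.2.1, ht.2.1]

/-- **THE TYPE-σ BLOCK IS AN `H_σ`-MODULE** by `t • ψ := R(t) ψ` (the composition law `R_R_eq_R_conv`, the unit `eσ`
acting as the identity on the block, the bilinearity of `R`). -/
instance instModuleHeckeAlg : Module (HeckeAlg S K ρ hKo hKc hρ hirr) (isotypicFixed S K ρ hKo hKc hρ) where
  smul := fun t ψ => ⟨S.R t ψ, S.R_mem_isotypicFixed K ρ hKo hKc hρ hirr t.2 ψ.2⟩
  one_smul := fun ψ => Subtype.ext ψ.2.2.2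
  mul_smul := fun t t' ψ => Subtype.ext (S.R_R_eq_R_conv t.2.1 t'.2.1 ψ.2.2.1).symm
  smul_zero := fun t => Subtype.ext (S.R_zero' t)
  smul_add := fun t ψ φ => Subtype.ext (S.R_add' t.2.1 ψ.2.2.1 φ.2.2.1)
  add_smul := fun t t' ψ => Subtype.ext (S.R_add_fun t.2.1 t'.2.1 ψ.2.2.1)
  zero_smul := fun ψ => Subtype.ext (S.R_zero_fun ψ)

/-- the `H_σ`-action on the block is the right-regular action of the test function (`rfl`) — p5's `hact` /
p2's `hact` for `tst := Subtype.val`. -/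
theorem hact_heckeAlg (t : HeckeAlg S K ρ hKo hKc hρ hirr) (ψ : isotypicFixed S K ρ hKo hKc hρ) :
    ((t • ψ : isotypicFixed S K ρ hKo hKc hρ) : G → ℂ) = S.R (t : G → ℂ) ψ := rfl

/-- the scalar tower `ℂ → H_σ → Vb` (`R(c • t) ψ = c • R(t) ψ`). -/
instance instIsScalarTowerHeckeAlg :
    IsScalarTower ℂ (HeckeAlg S K ρ hKo hKc hρ hirr) (isotypicFixed S K ρ hKo hKc hρ) :=
  ⟨fun c t ψ => Subtype.ext (S.R_smul_fun c t ψ)⟩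

include hKo hKc hρ hirr in
/-- **`hfull` IS A THEOREM for `H_σ`** («`e A e = H`»): for every test function `f`, `R(eσ)(R(f) ψ) = R(eσ ⋆ f ⋆ eσ) ψ` on
the block, and `eσ ⋆ f ⋆ eσ ∈ H_σ` (p2's `R_R_eq_R_conv_conv`). -/
theorem hfull_heckeAlg {f : G → ℂ} (hf : IsTest f) :
    ∃ r : HeckeAlg S K ρ hKo hKc hρ hirr, ∀ ψ ∈ isotypicFixed S K ρ hKo hKc hρ,
      S.R (eσ S K ρ) (S.R f ψ) = S.R (r : G → ℂ) ψ :=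
  ⟨⟨_, S.heckeElt_mem K ρ hKo hKc hρ hirr hf⟩, fun _ hψ =>
    S.R_R_eq_R_conv_conv (isTest_eσ S K ρ hKo hKc hρ) hf hψ.2.1 hψ.2.2⟩

omit [SecondCountableTopology G] [T2Space G] [MeasurableMul G] [SFinite S.μ] in
include hKo hKc hρ in
/-- `eσ` acts as the identity on the type-σ block (p2's `he_test`). -/
theorem he_test_heckeAlg : ∃ f₀, IsTest f₀ ∧ ∀ v ∈ isotypicFixed S K ρ hKo hKc hρ, S.R f₀ v = v :=
  ⟨eσ S K ρ, isTest_eσ S K ρ hKo hKc hρ, fun _ hv => hv.2.2⟩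

include hKo hKc hρ hirr in
/-- **(C1) FOR THE TYPE-σ BLOCK**: a constituent `τ m' ∩ Vb` of the type-σ block (`τ m'` invariant and irreducible,
`Wi` the `H_σ`-submodule of the block with `ψ ∈ Wi ↔ ψ ∈ τ m'`) containing a non-zero vector is a SIMPLE `H_σ`-module
(p2's `isSimpleModule_of_block` with `e := R(eσ)`, `hact` / `hfull` / `he_test` the theorems above). -/
theorem isSimpleModule_isotypic [Countable S.Gk] (hu : IsUnitaryRep ρ) {τ : ℕ → Set (G → ℂ)} (m' : ℕ)
    (hinv : S.IsInvariantSubspace (τ m')) (hirr' : S.IsIrreducible (τ m'))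
    (Wi : Submodule (HeckeAlg S K ρ hKo hKc hρ hirr) (isotypicFixed S K ρ hKo hKc hρ))
    (hWi : ∀ ψ : isotypicFixed S K ρ hKo hKc hρ, ψ ∈ Wi ↔ (ψ : G → ℂ) ∈ τ m')
    (hne : ∃ w : isotypicFixed S K ρ hKo hKc hρ, w ∈ Wi ∧ w ≠ 0) :
    IsSimpleModule (HeckeAlg S K ρ hKo hKc hρ hirr) Wi := by
  haveI := finiteDimensional_isotypicFixed S K ρ hKo hKc hρ hu
  have he := isTest_eσ S K ρ hKo hKc hρ
  refine S.isSimpleModule_of_block m' hinv hirr'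
    (fun t : HeckeAlg S K ρ hKo hKc hρ hirr => (t : G → ℂ)) (fun _ _ => rfl) Wi hWi (S.R (eσ S K ρ))
    ?_ ?_ ?_ ?_ ?_ (S.he_test_heckeAlg K ρ hKo hKc hρ) hne
  · intro ψ hψ φ hφ
    exact S.R_add' he (hinv.cont ψ hψ) (hinv.cont φ hφ)
  · intro ψ _ c
    exact S.R_smul' _ ψ c
  · intro ψ hψ φ hφ
    rw [S.inner_R_eq_inner_R_adj he (hinv.inv ψ hψ) (hinv.cont ψ hψ) (hinv.inv φ hφ) (hinv.cont φ hφ),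
      cj_refl_eσ S K ρ hu]
  · intro v hv
    exact hv.2.2
  · intro f hf
    exact S.hfull_heckeAlg K ρ hKo hKc hρ hirr hf

end Module

end RTF.Setting

end Summit.Ventures.HodgeRepro.Tier4.Line1
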